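import Mathlib
import Literature.Analysis.FluidPDE.WholeSpaceIBPEnstrophy
import Literature.Analysis.FluidPDE.WholeSpaceIBPIntegrable
import Literature.Analysis.FluidPDE.HarmonicProbe
import Literature.Analysis.FluidPDE.EnergyUniqueness
import Literature.Analysis.FluidPDE.SolenoidalTruncation
import Literature.Analysis.FluidPDE.MildSolutionProofs
import HarnessLib

/-!
# Similarity enstrophy, file 1/4: whole-space integrations by parts under integrability only
  (pub-ns-dss theory T38-SCOPE (S1); route `DssFarFieldSlaving`, crux `BlowupTypeIDssProfile`,
  stmt-NavierStokesRegularity-0155 — SUPPORT, label-free helper; typer seat g6, 2026-08-23)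

HONEST FRAMING. Label-free analysis helper for the T38-SCOPE plan of the cell's theory seat (S3 → S2 → S1 → S4;
LIOUVILLE-SIDE l.177): an IDENTITY / estimates for a HYPOTHETICAL object (the similarity vorticity of a Type-I ancient mild
field) under the NAMED space–time decay hypothesis (D), which is NOT derived from Type-I membership here. No census words
change (the explicit rows T31″ / T34 / T38 stay DERIVED until S4 lands); nothing numeric; nothing here bears on Navier–Stokes
regularity or blow-up. Idea credit for the Hardy-weighted stretching threshold: the OPEN item
`StretchingWellBinding.DssProfileBinding` (stmt-1578), not addressed here.

CONTENTS. The tree's cut-off identities of `WholeSpaceIBPEnstrophy` (`∫ φ⟪ΔW,W⟫ = −∫ φ|∇W|²_F + ½∫|W|²Δφ`,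
`2∫ φ⟪DW(y)y,W⟫ = −∫(Dφ(y)y)|W|² − dim ∫ φ|W|²`, `2∫ φ⟪(V·∇)W,W⟫ = −∫(Dφ(V))|W|²` for `div V = 0`)
with `φ = χ_R` the standard truncation (`cutoff`, `WholeSpaceIBP`) and `R → ∞` by dominated convergence:
* `exists_abs_laplacian_cutoff_le`: `|Δχ_R| ≤ C/R²` (from the tree's `exists_norm_fderiv_fderiv_cutoff_le`);
* `tendsto_integral_zero_of_norm_le_mul` (with the tree's `tendsto_integral_cutoff_mul`),
  `tendsto_integral_fderiv_cutoff_self_mul`, `tendsto_integral_fderiv_cutoff_apply_mul`: truncation limits;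
* `integral_inner_laplacian_self_eq_neg_integral_frobeniusNormSq` (`∫⟪ΔW,W⟫ = −∫|∇W|²_F`),
  `two_mul_integral_inner_fderiv_self_self_eq` (`2∫⟪DW(y)y,W⟫ = −dim·∫|W|²` — the flux `|W|²y` need
  NOT be integrable), `integral_inner_convect_self_eq_zero` (`∫⟪(V·∇)W,W⟫ = 0`, `V` bounded, div-free),
  for `W ∈ C^∞` with `|W|²` and the relevant pairings in `L¹`. This is exactly what the decay hypothesis
  (D) delivers for the similarity vorticity on `ℝ³` (`|Ω|² ∼ |y|^{−4} ∈ L¹`, drift flux `∼ |y|^{−3} ∉ L¹`).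
[this file; folklore (Evans App. C.2, Majda–Bertozzi §1.2); theory T38-SCOPE (S1)]
-/

noncomputable section

set_option linter.dupNamespace false

namespace Summit.NavierStokesRegularity.NavierStokesRegularity.Theorems.SimilarityEnstrophy

open MeasureTheory Set Filter Topology Module Metric InnerProductSpace
open scoped RealInnerProductSpace Laplacian ContDiff
open Literature.Analysis Literature.Analysis.FluidPDE

variable {E : Type*} [NormedAddCommGroup E] [InnerProductSpace ℝ E] [FiniteDimensional ℝ E]
  [MeasurableSpace E] [BorelSpace E]
variable {F' : Type*} [NormedAddCommGroup F'] [InnerProductSpace ℝ F']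

/-! ### Second-order bound for the cut-off -/

omit [MeasurableSpace E] [BorelSpace E] in
/-- **Laplacian bound for the cut-off:** `|Δ(cutoff R)(x)| ≤ C / R²` (`|Δf| ≤ dim · ‖D²f‖`). [folklore] -/
theorem exists_abs_laplacian_cutoff_le :
    ∃ C : ℝ, 0 ≤ C ∧ ∀ R : ℝ, 0 < R → ∀ x : E, |(Δ (cutoff (E := E) R)) x| ≤ C / R ^ 2 := by
  obtain ⟨C, hC0, hC⟩ := exists_norm_fderiv_fderiv_cutoff_le (E := E)
  refine ⟨finrank ℝ E * C, mul_nonneg (Nat.cast_nonneg _) hC0, fun R hR x => ?_⟩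
  rw [← Real.norm_eq_abs]
  calc ‖(Δ (cutoff (E := E) R)) x‖ ≤ finrank ℝ E * ‖fderiv ℝ (fderiv ℝ (cutoff R)) x‖ :=
        norm_laplacian_le _ _
    _ ≤ finrank ℝ E * (C / R ^ 2) := by gcongr; exact hC R hR x
    _ = finrank ℝ E * C / R ^ 2 := by ring

/-! ### Truncation limits -/

/-- If `|g_n(x)| ≤ ε_n |f(x)|` with `f ∈ L¹` and `ε_n → 0`, then `∫ g_n → 0`. [folklore] -/
theorem tendsto_integral_zero_of_norm_le_mul {f : E → ℝ} (hf : Integrable f) {g : ℕ → E → ℝ}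
    {ε : ℕ → ℝ} (hε : Tendsto ε atTop (𝓝 0)) (hg : ∀ n x, ‖g n x‖ ≤ ε n * ‖f x‖) :
    Tendsto (fun n => ∫ x, g n x) atTop (𝓝 0) := by
  have hbound : ∀ n, ‖∫ x, g n x‖ ≤ ε n * ∫ x, ‖f x‖ := by
    intro n
    rw [← integral_const_mul]
    exact norm_integral_le_of_norm_le (hf.norm.const_mul _) (Eventually.of_forall (hg n))
  have hlim : Tendsto (fun n => ε n * ∫ x, ‖f x‖) atTop (𝓝 0) := by
    simpa using hε.mul_const (∫ x, ‖f x‖)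
  exact squeeze_zero_norm hbound hlim

omit [InnerProductSpace ℝ F'] in
/-- `∫ (Dχ_{n+1}(x) x) |W(x)|² dx → 0` when `|W|² ∈ L¹`: the integrand is bounded by `2c |W|²` and
supported where `‖x‖ ≥ n + 1`, so it tends to `0` pointwise (dominated convergence). [folklore] -/
theorem tendsto_integral_fderiv_cutoff_self_mul {W : E → F'} (hW : Continuous W)
    (hW2 : Integrable fun x => ‖W x‖ ^ 2) :
    Tendsto (fun n : ℕ => ∫ x, fderiv ℝ (cutoff ((n : ℝ) + 1)) x x * ‖W x‖ ^ 2) atTop (𝓝 0) := by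
  obtain ⟨c, hc0, hc⟩ := exists_norm_fderiv_cutoff_le (E := E)
  have hzero : ∀ (R : ℝ), 0 < R → ∀ x : E, ‖x‖ < R → fderiv ℝ (cutoff (E := E) R) x = 0 := by
    intro R hR x hx
    have h : (cutoff (E := E) R) =ᶠ[𝓝 x] fun _ => (1 : ℝ) := by
      filter_upwards [Metric.isOpen_ball.mem_nhds (mem_ball_zero_iff.2 hx)] with y hy
      exact cutoff_eq_one hR (mem_ball_zero_iff.1 hy).le
    rw [h.fderiv_eq, fderiv_const_apply]
  have hzero' : ∀ (R : ℝ), 0 < R → ∀ x : E, 2 * R < ‖x‖ → fderiv ℝ (cutoff (E := E) R) x = 0 := by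
    intro R hR x hx
    have h : (cutoff (E := E) R) =ᶠ[𝓝 x] fun _ => (0 : ℝ) := by
      filter_upwards [(isOpen_lt continuous_const continuous_norm).mem_nhds hx] with y hy
      exact cutoff_eq_zero hR (le_of_lt hy)
    rw [h.fderiv_eq, fderiv_const_apply]
  -- pointwise bound `|Dχ_R(x) x| ≤ 2c`
  have hpt : ∀ (R : ℝ), 0 < R → ∀ x : E, ‖fderiv ℝ (cutoff R) x x‖ ≤ 2 * c := by
    intro R hR x
    by_cases hx : 2 * R < ‖x‖
    · rw [hzero' R hR x hx]
      rw [show (0 : E →L[ℝ] ℝ) x = 0 from rfl, norm_zero]; positivity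
    · rw [not_lt] at hx
      calc ‖fderiv ℝ (cutoff R) x x‖ ≤ ‖fderiv ℝ (cutoff R) x‖ * ‖x‖ := ContinuousLinearMap.le_opNorm _ _
        _ ≤ c / R * (2 * R) := mul_le_mul (hc R hR x) hx (norm_nonneg _) (div_nonneg hc0 hR.le)
        _ = 2 * c := by field_simp
  have hmeas : ∀ n : ℕ, AEStronglyMeasurable
      (fun x => fderiv ℝ (cutoff ((n : ℝ) + 1)) x x * ‖W x‖ ^ 2) (volume : Measure E) := fun n =>
    (((contDiff_cutoff (E := E) (n := 1) ((n : ℝ) + 1)).continuous_fderiv one_ne_zero).clm_apply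
      continuous_id).aestronglyMeasurable.mul (hW.norm.pow 2).aestronglyMeasurable
  have h := tendsto_integral_of_dominated_convergence (μ := (volume : Measure E))
    (F := fun (n : ℕ) x => fderiv ℝ (cutoff ((n : ℝ) + 1)) x x * ‖W x‖ ^ 2) (f := fun _ => (0 : ℝ))
    (fun x => 2 * c * ‖W x‖ ^ 2) hmeas (hW2.const_mul _) ?_ ?_
  · simpa using h
  · intro n
    filter_upwards with x
    rw [norm_mul, norm_pow, norm_norm]
    exact mul_le_mul_of_nonneg_right (hpt _ (by positivity) x) (sq_nonneg _)
  · filter_upwards with x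
    have hev : ∀ᶠ n : ℕ in atTop, fderiv ℝ (cutoff ((n : ℝ) + 1)) x x * ‖W x‖ ^ 2 = 0 := by
      filter_upwards [eventually_gt_atTop ⌈‖x‖⌉₊] with n hn
      have hxn : ‖x‖ < (n : ℝ) + 1 :=
        ((Nat.le_ceil ‖x‖).trans_lt (by exact_mod_cast hn)).trans (lt_add_one _)
      rw [hzero _ (by positivity) x hxn, show (0 : E →L[ℝ] ℝ) x = 0 from rfl, zero_mul]
    exact tendsto_const_nhds.congr' (hev.mono fun n hn => hn.symm)

omit [InnerProductSpace ℝ F'] in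
/-- `∫ (Dχ_{n+1}(x) (V x)) |W(x)|² dx → 0` when `|W|² ∈ L¹` and `V` is bounded (`‖Dχ_R‖ ≤ c/R`).
[folklore] -/
theorem tendsto_integral_fderiv_cutoff_apply_mul {W : E → F'}
    (hW2 : Integrable fun x => ‖W x‖ ^ 2) {V : E → E} {M : ℝ} (hVb : ∀ x, ‖V x‖ ≤ M) :
    Tendsto (fun n : ℕ => ∫ x, fderiv ℝ (cutoff ((n : ℝ) + 1)) x (V x) * ‖W x‖ ^ 2) atTop (𝓝 0) := by
  obtain ⟨c, hc0, hc⟩ := exists_norm_fderiv_cutoff_le (E := E)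
  have hM : 0 ≤ M := (norm_nonneg _).trans (hVb 0)
  refine tendsto_integral_zero_of_norm_le_mul hW2 (ε := fun n => c / ((n : ℝ) + 1) * M) ?_ ?_
  · have h1 : Tendsto (fun n : ℕ => c / ((n : ℝ) + 1)) atTop (𝓝 0) :=
      tendsto_const_nhds.div_atTop (tendsto_natCast_atTop_atTop.atTop_add tendsto_const_nhds)
    simpa using h1.mul_const M
  · intro n x
    rw [norm_mul, norm_pow, norm_norm]
    refine mul_le_mul_of_nonneg_right ?_ (sq_nonneg _)
    calc ‖fderiv ℝ (cutoff ((n : ℝ) + 1)) x (V x)‖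
        ≤ ‖fderiv ℝ (cutoff ((n : ℝ) + 1)) x‖ * ‖V x‖ := ContinuousLinearMap.le_opNorm _ _
      _ ≤ c / ((n : ℝ) + 1) * M :=
          mul_le_mul (hc _ (by positivity) x) (hVb x) (norm_nonneg _) (div_nonneg hc0 (by positivity))

/-! ### The three integrations by parts under integrability -/

/-- **Green's identity for a field with square-integrable value, gradient and Laplacian pairing:**
`∫ ⟪ΔW, W⟫ = −∫ |∇W|²_F` for `W ∈ C^∞(E; F')` with `|W|²`, `|∇W|²_F` and `⟪ΔW, W⟫` integrable (no
decay RATE required). Proof: the cut-off identity `integral_mul_inner_laplacian_self_eq` with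
`φ = χ_R`, `|Δχ_R| ≤ C/R²`, and `R → ∞`. [folklore] -/
theorem integral_inner_laplacian_self_eq_neg_integral_frobeniusNormSq [FiniteDimensional ℝ F']
    {W : E → F'} (hW : ContDiff ℝ ∞ W) (hW2 : Integrable fun x => ‖W x‖ ^ 2)
    (hF : Integrable fun x => frobeniusNormSq (fderiv ℝ W x))
    (hL : Integrable fun x => ⟪(Δ W) x, W x⟫) :
    ∫ x, ⟪(Δ W) x, W x⟫ = -∫ x, frobeniusNormSq (fderiv ℝ W x) := by
  obtain ⟨C, hC0, hC⟩ := exists_abs_laplacian_cutoff_le (E := E)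
  -- the cut-off identity at `R = n + 1`
  have hn : ∀ n : ℕ, ∫ x, cutoff ((n : ℝ) + 1) x * ⟪(Δ W) x, W x⟫ =
      -(∫ x, cutoff ((n : ℝ) + 1) x * frobeniusNormSq (fderiv ℝ W x)) +
        (1 / 2) * ∫ x, ‖W x‖ ^ 2 * (Δ (cutoff (E := E) ((n : ℝ) + 1))) x := fun n =>
    integral_mul_inner_laplacian_self_eq (contDiff_cutoff _)
      (hasCompactSupport_cutoff (E := E) (R := (n : ℝ) + 1) (by positivity)) hW
  have hL' := tendsto_integral_cutoff_mul hL
  have hF' := tendsto_integral_cutoff_mul hF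
  have hE : Tendsto (fun n : ℕ => ∫ x, ‖W x‖ ^ 2 * (Δ (cutoff (E := E) ((n : ℝ) + 1))) x) atTop (𝓝 0) := by
    refine tendsto_integral_zero_of_norm_le_mul hW2 (ε := fun n => C / ((n : ℝ) + 1) ^ 2) ?_ ?_
    · have h1 : Tendsto (fun n : ℕ => ((n : ℝ) + 1) ^ 2) atTop atTop :=
        (tendsto_pow_atTop two_ne_zero).comp
          (tendsto_natCast_atTop_atTop.atTop_add tendsto_const_nhds)
      exact tendsto_const_nhds.div_atTop h1
    · intro n x
      rw [norm_mul, norm_pow, norm_norm, mul_comm]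
      exact mul_le_mul_of_nonneg_right (by rw [Real.norm_eq_abs]; exact hC _ (by positivity) x)
        (sq_nonneg _)
  have hlim : Tendsto (fun n : ℕ => ∫ x, cutoff ((n : ℝ) + 1) x * ⟪(Δ W) x, W x⟫) atTop
      (𝓝 (-(∫ x, frobeniusNormSq (fderiv ℝ W x)) + (1 / 2) * 0)) := by
    simp_rw [hn]
    exact hF'.neg.add (hE.const_mul _)
  rw [mul_zero, add_zero] at hlim
  exact tendsto_nhds_unique hL' hlim

/-- **Leray drift:** `2 ∫ ⟪(y·∇)W, W⟫ = −(dim E) ∫ |W|²` for `W ∈ C^∞(E; F')` with `|W|²` and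
`⟪DW(y) y, W(y)⟫` integrable — the flux `|W|² y` need NOT be integrable (cut-off identity
`two_mul_integral_mul_inner_fderiv_self_self_eq`, `|Dχ_R(y) y| ≤ 2c` on the shell, `R → ∞`). [folklore] -/
theorem two_mul_integral_inner_fderiv_self_self_eq {W : E → F'} (hW : ContDiff ℝ ∞ W)
    (hW2 : Integrable fun x => ‖W x‖ ^ 2)
    (hD : Integrable fun x => ⟪fderiv ℝ W x x, W x⟫) :
    2 * ∫ x, ⟪fderiv ℝ W x x, W x⟫ = -(finrank ℝ E : ℝ) * ∫ x, ‖W x‖ ^ 2 := by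
  have hn : ∀ n : ℕ, 2 * (∫ x, cutoff ((n : ℝ) + 1) x * ⟪fderiv ℝ W x x, W x⟫) =
      -(∫ x, fderiv ℝ (cutoff ((n : ℝ) + 1)) x x * ‖W x‖ ^ 2) -
        (finrank ℝ E : ℝ) * ∫ x, cutoff ((n : ℝ) + 1) x * ‖W x‖ ^ 2 := fun n =>
    two_mul_integral_mul_inner_fderiv_self_self_eq (contDiff_cutoff _)
      (hasCompactSupport_cutoff (E := E) (R := (n : ℝ) + 1) (by positivity)) hW
  have hD' := tendsto_integral_cutoff_mul hD
  have hW2' := tendsto_integral_cutoff_mul hW2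
  have hE := tendsto_integral_fderiv_cutoff_self_mul hW.continuous hW2
  have hlim : Tendsto (fun n : ℕ => 2 * ∫ x, cutoff ((n : ℝ) + 1) x * ⟪fderiv ℝ W x x, W x⟫) atTop
      (𝓝 (-(0 : ℝ) - (finrank ℝ E : ℝ) * ∫ x, ‖W x‖ ^ 2)) := by
    simp_rw [hn]
    exact hE.neg.sub (hW2'.const_mul _)
  rw [neg_zero, zero_sub, ← neg_mul] at hlim
  exact tendsto_nhds_unique (hD'.const_mul 2) hlim

/-- **Incompressible transport:** `∫ ⟪(V·∇)W, W⟫ = 0` for `W ∈ C^∞(E; F')` with `|W|²` and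
`⟪(V·∇)W, W⟫` integrable and a smooth, bounded, divergence-free `V` (cut-off identity
`two_mul_integral_mul_inner_convect_self_eq_of_isDivFree`, `|Dχ_R(V)| ≤ cM/R`, `R → ∞`). [folklore] -/
theorem integral_inner_convect_self_eq_zero {W : E → F'} {V : E → E} (hW : ContDiff ℝ ∞ W)
    (hV : ContDiff ℝ ∞ V) (hdiv : VectorCalculus.IsDivFree V) {M : ℝ} (hVb : ∀ x, ‖V x‖ ≤ M)
    (hW2 : Integrable fun x => ‖W x‖ ^ 2)
    (hT : Integrable fun x => ⟪convect V W x, W x⟫) :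
    ∫ x, ⟪convect V W x, W x⟫ = 0 := by
  have hn : ∀ n : ℕ, 2 * (∫ x, cutoff ((n : ℝ) + 1) x * ⟪convect V W x, W x⟫) =
      -(∫ x, fderiv ℝ (cutoff ((n : ℝ) + 1)) x (V x) * ‖W x‖ ^ 2) := fun n =>
    two_mul_integral_mul_inner_convect_self_eq_of_isDivFree (contDiff_cutoff _)
      (hasCompactSupport_cutoff (E := E) (R := (n : ℝ) + 1) (by positivity)) hW hV hdiv
  have hT' := tendsto_integral_cutoff_mul hT
  have hE := tendsto_integral_fderiv_cutoff_apply_mul hW2 hVb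
  have hlim : Tendsto (fun n : ℕ => 2 * ∫ x, cutoff ((n : ℝ) + 1) x * ⟪convect V W x, W x⟫) atTop
      (𝓝 (-(0 : ℝ))) := by
    simp_rw [hn]
    exact hE.neg
  rw [neg_zero] at hlim
  have h2 := tendsto_nhds_unique (hT'.const_mul 2) hlim
  linarith

end Summit.NavierStokesRegularity.NavierStokesRegularity.Theorems.SimilarityEnstrophy
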